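/-
Copyright: the b2b-balaban T⁴-continuum CRUX team, row NE7b leaf lineage `t4-ne7b-formalise-leaf-06` (gen 147). Project licence.
-/
import Summits.QuantumFields.BalabanUV.T4Continuum.Spine.NE7b.ConvexSlabWindowMass

/-!
# TILTED MEDIANS EXIST: the `θ = ½` letter of the slab-window mass bound, unconditionally
# (row NE7b, node U5c; companion of `…ConvexSlabWindowMass`; kernel lemmas of real analysis)

Cell `pub-balaban`, sub-cell `t4`, spine estimate NE7b (`T4WeightBudget.RelWeightBound`; the cell's OWN estimate — NOT PRINTED in
[Bałaban 1983–89], NOT PROVED).  Crux-route work under `Spine/NE7b/` by a row leaf on the convexity road; NOTHING of Bałaban's is named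
or asserted; no `T4Continuum/Support` leaf typed; no `def`; zero `sorry`.

WHY.  `…ConvexSlabWindowMass.slabWindowMass_ge` (the `hmass` letter of the convexity road for slab ∕ per-bond windows,
`η = 2|ι|e^{−λρ²∕4}∕θ`) DISPLAYS centres `c_i` whose two closed half-spaces `{⟪u_i,x⟫ ≤ c_i}`, `{c_i ≤ ⟪u_i,x⟫}` each carry at least the
fraction `θ` of `∫e^{−V}`; its §3 supplies `θ = ½` under central symmetry.  THIS FILE supplies `θ = ½` WITHOUT symmetry: along every
direction `u` a MEDIAN level exists (closes `…ConvexSlabWindowMass`'s NOT-HERE item «existence of tilted medians»).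

WHAT IS PROVED ([folklore]; the distribution function `F(a) = ∫_{⟪u,x⟫ ≤ a} e^{−V}` is monotone, tends to `Z` ∕ `0` at `±∞`, is
right-continuous and has left limits `∫_{⟪u,x⟫ < a} e^{−V}` — Mathlib's `tendsto_setIntegral_of_monotone ∕ _of_antitone`; the median is
`m = inf {a | ½Z ≤ F a}`): **`exists_median_halfSpaceMass`** (`∃ m`, both closed half-spaces carry `≥ ½∫e^{−V}`; needs only
`Integrable (e^{−V})`) and **`slabWindowMass_ge_at_medians`** (`∃ c : ι → ℝ`, the slab window of half-width `ρ` about `c` carries all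
but `η = 4|ι|e^{−λρ²∕4}` of the mass — `slabWindowMass_ge` at `θ = ½`); §3 (v1.1) **`setIntegral_slab_mono_of_near`** (pure inclusion:
`|c'_i − c_i| ≤ δ` ⇒ the `ρ`-slab about `c'` sits inside the `(ρ+δ)`-slab about `c`) and **`slabWindowMass_ge_of_near_medians`** — THE
CENTRING SOCKET: `θ`-medians `m_i` within `δ` of prescribed centres `c_i` ⇒ `(1 − 2|ι|e^{−λρ²∕4}∕θ)·Z ≤ ∫_{∀ i, |⟪u_i,x⟫ − c_i| < ρ+δ} e^{−V}`
(the instance supplies only `δ`; PRICING-NE7b v81 F428's suggestion).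

NOT HERE (honest): the VALUE of `δ` for print's centres (an (A1c) ∕ (R1″) reading — e.g. `|median − mean| ≤ √(2·Var) ≤ √(2∕λ)` plus
the road's tilted-mean letter, or symmetry; the companion `…ConvexSlabWindowTiltedMeans` centres at the tilted MEANS directly); anything
of Bałaban's.  NE7b NOT PRINTED ∕ NOT PROVED; spine
PROVED 0∕9; rung (B)+1 on a FINITE torus — NOT infinite volume, NOT the mass gap, NOT Clay.
HONEST DEPENDENCY: continuum YM on T⁴ ⇐ BetaPertH ∧ nine spine estimates (0/9 proved); BetaPertH ⇐ (D1) ∧ (D4) ∧ CAP+tail.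
-/

set_option autoImplicit false

noncomputable section

open MeasureTheory Real Filter Topology
open scoped RealInnerProductSpace

namespace Summit.QuantumFields.BalabanUV.T4Continuum.NE7b.ConvexSlabWindowMedians

open Summit.QuantumFields.BalabanUV.T4Continuum.NE7b.ConvexSlabWindowMass

variable {n : ℕ}

/-- **TILTED MEDIANS EXIST** (the `θ = ½` letter of `slabWindowMass_ge`, unconditionally): for `e^{−V}` integrable and any `u`
there is a level `m` such that BOTH closed half-spaces `{⟪u,x⟫ ≤ m}` and `{m ≤ ⟪u,x⟫}` carry at least `½·∫e^{−V}`
(`m = inf {a | ½Z ≤ ∫_{⟪u,x⟫ ≤ a} e^{−V}}`; continuity of the set integral from above and from below). [folklore] -/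
theorem exists_median_halfSpaceMass {V : EuclideanSpace ℝ (Fin n) → ℝ} (hZ : Integrable fun x => exp (-V x))
    (u : EuclideanSpace ℝ (Fin n)) :
    ∃ m : ℝ, 1 / 2 * ∫ z, exp (-V z) ≤ ∫ x in {x | ⟪u, x⟫ ≤ m}, exp (-V x) ∧
      1 / 2 * ∫ z, exp (-V z) ≤ ∫ x in {x | m ≤ ⟪u, x⟫}, exp (-V x) := by
  set Z : ℝ := ∫ z, exp (-V z) with hZdef
  have hZpos : 0 < Z := integral_exp_pos hZ
  have hum : Measurable fun x : EuclideanSpace ℝ (Fin n) => ⟪u, x⟫ :=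
    (continuous_const.inner continuous_id).measurable
  have hSm : ∀ a : ℝ, MeasurableSet {x : EuclideanSpace ℝ (Fin n) | ⟪u, x⟫ ≤ a} :=
    fun a => measurableSet_le hum measurable_const
  have hnn : 0 ≤ᵐ[volume] fun x : EuclideanSpace ℝ (Fin n) => exp (-V x) := ae_of_all _ fun _ => (exp_pos _).le
  -- the distribution function along `u`
  set F : ℝ → ℝ := fun a => ∫ x in {x | ⟪u, x⟫ ≤ a}, exp (-V x) with hF
  have hFmono : Monotone F := by
    intro a b hab
    exact setIntegral_mono_set hZ.integrableOn (ae_restrict_of_ae hnn)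
      (ae_of_all _ fun x (hx : ⟪u, x⟫ ≤ a) => show ⟪u, x⟫ ≤ b from hx.trans hab)
  -- `F k → Z` and `F (−k) → 0`
  have htop : Tendsto (fun k : ℕ => F k) atTop (𝓝 Z) := by
    have hmono : Monotone fun k : ℕ => {x : EuclideanSpace ℝ (Fin n) | ⟪u, x⟫ ≤ (k : ℝ)} :=
      fun k l hkl x (hx : ⟪u, x⟫ ≤ k) => show ⟪u, x⟫ ≤ l from hx.trans (by exact_mod_cast hkl)
    have hU : (⋃ k : ℕ, {x : EuclideanSpace ℝ (Fin n) | ⟪u, x⟫ ≤ (k : ℝ)}) = Set.univ := by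
      ext x
      simp only [Set.mem_iUnion, Set.mem_setOf_eq, Set.mem_univ, iff_true]
      exact exists_nat_ge ⟪u, x⟫
    have h := tendsto_setIntegral_of_monotone (μ := volume) (f := fun x => exp (-V x))
      (s := fun k : ℕ => {x : EuclideanSpace ℝ (Fin n) | ⟪u, x⟫ ≤ (k : ℝ)}) (fun k => hSm k) hmono hZ.integrableOn
    beta_reduce at h
    rwa [hU, setIntegral_univ] at h
  have hbot : Tendsto (fun k : ℕ => F (-(k : ℝ))) atTop (𝓝 0) := by
    have hanti : Antitone fun k : ℕ => {x : EuclideanSpace ℝ (Fin n) | ⟪u, x⟫ ≤ -(k : ℝ)} :=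
      fun k l hkl x (hx : ⟪u, x⟫ ≤ -(l : ℝ)) => show ⟪u, x⟫ ≤ -(k : ℝ) from hx.trans (by simpa using hkl)
    have hI : (⋂ k : ℕ, {x : EuclideanSpace ℝ (Fin n) | ⟪u, x⟫ ≤ -(k : ℝ)}) = ∅ := by
      ext x
      simp only [Set.mem_iInter, Set.mem_setOf_eq, Set.mem_empty_iff_false, iff_false, not_forall, not_le]
      obtain ⟨k, hk⟩ := exists_nat_gt (-⟪u, x⟫)
      exact ⟨k, by linarith⟩
    have h := tendsto_setIntegral_of_antitone (μ := volume) (f := fun x => exp (-V x))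
      (s := fun k : ℕ => {x : EuclideanSpace ℝ (Fin n) | ⟪u, x⟫ ≤ -(k : ℝ)}) (fun k => hSm _) hanti
      ⟨0, hZ.integrableOn⟩
    beta_reduce at h
    rwa [hI, setIntegral_empty] at h
  -- the set of half-median levels is nonempty and bounded below
  set S : Set ℝ := {a | Z / 2 ≤ F a} with hS
  obtain ⟨k₁, hk₁⟩ := (htop.eventually (eventually_gt_nhds (by linarith : Z / 2 < Z))).exists
  obtain ⟨k₀, hk₀⟩ := (hbot.eventually (eventually_lt_nhds (by linarith : (0 : ℝ) < Z / 2))).exists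
  have hSne : S.Nonempty := ⟨k₁, hk₁.le⟩
  have hSbdd : BddBelow S := by
    refine ⟨-(k₀ : ℝ), fun a ha => ?_⟩
    by_contra h
    have h' : a < -(k₀ : ℝ) := not_le.1 h
    have := hFmono h'.le
    exact absurd (ha.trans this) (not_le.2 hk₀)
  set m : ℝ := sInf S with hm
  refine ⟨m, ?_, ?_⟩
  · -- right-continuity: `F (m + 1∕(k+1)) → F m`, each term `≥ Z∕2`
    have hanti : Antitone fun k : ℕ => {x : EuclideanSpace ℝ (Fin n) | ⟪u, x⟫ ≤ m + 1 / ((k : ℝ) + 1)} := by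
      intro k l hkl x hx
      simp only [Set.mem_setOf_eq] at hx ⊢
      have hkl' : (1 : ℝ) / ((l : ℝ) + 1) ≤ 1 / ((k : ℝ) + 1) :=
        one_div_le_one_div_of_le (by positivity) (by exact_mod_cast Nat.succ_le_succ hkl)
      linarith
    have hI : (⋂ k : ℕ, {x : EuclideanSpace ℝ (Fin n) | ⟪u, x⟫ ≤ m + 1 / ((k : ℝ) + 1)}) = {x | ⟪u, x⟫ ≤ m} := by
      ext x
      simp only [Set.mem_iInter, Set.mem_setOf_eq]
      constructor
      · intro h
        by_contra hlt
        have hlt' : m < ⟪u, x⟫ := not_le.1 hlt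
        obtain ⟨k, hk⟩ := exists_nat_one_div_lt (by linarith : 0 < ⟪u, x⟫ - m)
        have := h k
        linarith
      · intro h k
        have : (0 : ℝ) ≤ 1 / ((k : ℝ) + 1) := by positivity
        linarith
    have hT := tendsto_setIntegral_of_antitone (μ := volume) (f := fun x => exp (-V x))
      (s := fun k : ℕ => {x : EuclideanSpace ℝ (Fin n) | ⟪u, x⟫ ≤ m + 1 / ((k : ℝ) + 1)}) (fun k => hSm _) hanti
      ⟨0, hZ.integrableOn⟩
    beta_reduce at hT
    rw [hI] at hT
    have hge : ∀ k : ℕ, Z / 2 ≤ ∫ x in {x | ⟪u, x⟫ ≤ m + 1 / ((k : ℝ) + 1)}, exp (-V x) := by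
      intro k
      have hpos : (0 : ℝ) < 1 / ((k : ℝ) + 1) := by positivity
      have hlt : sInf S < m + 1 / ((k : ℝ) + 1) := by rw [← hm]; linarith
      obtain ⟨a, haS, hak⟩ := exists_lt_of_csInf_lt hSne hlt
      exact le_trans haS (hFmono hak.le)
    have := ge_of_tendsto' hT hge
    linarith
  · -- left limits: `F (m − 1∕(k+1)) → ∫_{⟪u,x⟫ < m}`, each term `< Z∕2`
    have hLm : MeasurableSet {x : EuclideanSpace ℝ (Fin n) | ⟪u, x⟫ < m} := measurableSet_lt hum measurable_const
    have hcompl : {x : EuclideanSpace ℝ (Fin n) | ⟪u, x⟫ < m}ᶜ = {x | m ≤ ⟪u, x⟫} := by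
      ext x; simp [not_lt]
    have hsplit := integral_add_compl hLm hZ
    rw [hcompl] at hsplit
    have hmono : Monotone fun k : ℕ => {x : EuclideanSpace ℝ (Fin n) | ⟪u, x⟫ ≤ m - 1 / ((k : ℝ) + 1)} := by
      intro k l hkl x hx
      simp only [Set.mem_setOf_eq] at hx ⊢
      have hkl' : (1 : ℝ) / ((l : ℝ) + 1) ≤ 1 / ((k : ℝ) + 1) :=
        one_div_le_one_div_of_le (by positivity) (by exact_mod_cast Nat.succ_le_succ hkl)
      linarith
    have hU : (⋃ k : ℕ, {x : EuclideanSpace ℝ (Fin n) | ⟪u, x⟫ ≤ m - 1 / ((k : ℝ) + 1)}) = {x | ⟪u, x⟫ < m} := by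
      ext x
      simp only [Set.mem_iUnion, Set.mem_setOf_eq]
      constructor
      · rintro ⟨k, hk⟩
        have : (0 : ℝ) < 1 / ((k : ℝ) + 1) := by positivity
        linarith
      · intro h
        obtain ⟨k, hk⟩ := exists_nat_one_div_lt (by linarith : 0 < m - ⟪u, x⟫)
        exact ⟨k, by linarith⟩
    have hT := tendsto_setIntegral_of_monotone (μ := volume) (f := fun x => exp (-V x))
      (s := fun k : ℕ => {x : EuclideanSpace ℝ (Fin n) | ⟪u, x⟫ ≤ m - 1 / ((k : ℝ) + 1)}) (fun k => hSm _) hmono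
      hZ.integrableOn
    beta_reduce at hT
    rw [hU] at hT
    have hle : ∀ k : ℕ, ∫ x in {x | ⟪u, x⟫ ≤ m - 1 / ((k : ℝ) + 1)}, exp (-V x) ≤ Z / 2 := by
      intro k
      have hpos : (0 : ℝ) < 1 / ((k : ℝ) + 1) := by positivity
      have hnot : m - 1 / ((k : ℝ) + 1) ∉ S := fun h => by
        have := csInf_le hSbdd h
        rw [← hm] at this
        linarith
      exact (not_le.1 hnot).le
    have := le_of_tendsto' hT hle
    linarith

/-- **THE SLAB WINDOW ABOUT THE TILTED MEDIANS** (`θ = ½` SUPPLIED unconditionally by `exists_median_halfSpaceMass`): for `V`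
`λ`-uniformly convex with `e^{−V}` integrable, functionals `‖u_i‖ ≤ 1` and `ρ ≥ 0`, there are centres `c_i` (medians of `⟪u_i,·⟫` under
`e^{−V}dx`) whose slab window carries all but the fraction `η = 4|ι|e^{−λρ²∕4}` of the mass. [folklore] -/
theorem slabWindowMass_ge_at_medians {ι : Type*} [Fintype ι] {V : EuclideanSpace ℝ (Fin n) → ℝ} {lam : ℝ}
    (hlam : 0 < lam) (hVc : Continuous V)
    (hV : ∀ x y : EuclideanSpace ℝ (Fin n), V x + ⟪gradient V x, y - x⟫ + lam / 2 * ‖y - x‖ ^ 2 ≤ V y)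
    (hZ : Integrable fun x => exp (-V x)) (u : ι → EuclideanSpace ℝ (Fin n)) (hu : ∀ i, ‖u i‖ ≤ 1) {ρ : ℝ}
    (hρ : 0 ≤ ρ) :
    ∃ c : ι → ℝ, (1 - 4 * Fintype.card ι * exp (-(lam * ρ ^ 2 / 4))) * ∫ z, exp (-V z) ≤
      ∫ x in {x | ∀ i, |⟪u i, x⟫ - c i| < ρ}, exp (-V x) := by
  choose c hc using fun i => exists_median_halfSpaceMass hZ (u i)
  refine ⟨c, ?_⟩
  have h := slabWindowMass_ge hlam hVc hV hZ u hu c hρ (by norm_num : (0 : ℝ) < 1 / 2)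
    (fun i => (hc i).1) (fun i => (hc i).2)
  have hη : (1 - 2 * Fintype.card ι * exp (-(lam * ρ ^ 2 / 4)) / (1 / 2)) =
      1 - 4 * Fintype.card ι * exp (-(lam * ρ ^ 2 / 4)) := by ring
  rwa [hη] at h

/-! ## §3 Re-centring: the centring socket (the instance supplies only `δ`) -/

/-- **RE-CENTRING A SLAB** (pure inclusion, no convexity): if `|c'_i − c_i| ≤ δ` for every constraint, the slab of half-width `ρ`
about `c'` lies inside the slab of half-width `ρ + δ` about `c`, so its `e^{−V}`-mass is at most the latter's. [folklore] -/
theorem setIntegral_slab_mono_of_near {ι : Type*} {V : EuclideanSpace ℝ (Fin n) → ℝ} (hZ : Integrable fun x => exp (-V x))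
    (u : ι → EuclideanSpace ℝ (Fin n)) {c c' : ι → ℝ} {ρ δ : ℝ} (hnear : ∀ i, |c' i - c i| ≤ δ) :
    ∫ x in {x | ∀ i, |⟪u i, x⟫ - c' i| < ρ}, exp (-V x) ≤ ∫ x in {x | ∀ i, |⟪u i, x⟫ - c i| < ρ + δ}, exp (-V x) := by
  refine setIntegral_mono_set hZ.integrableOn (ae_of_all _ fun _ => (exp_pos _).le) (ae_of_all _ fun x hx => ?_)
  intro i
  have hxi : |⟪u i, x⟫ - c' i| < ρ := hx i
  have htri := abs_sub_le ⟪u i, x⟫ (c' i) (c i)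
  show |⟪u i, x⟫ - c i| < ρ + δ
  linarith [hnear i]

/-- **THE CENTRING SOCKET** (`slabWindowMass_ge_of_near_medians`): if along every `u_i` some level `m_i` has BOTH closed half-spaces
carrying `≥ θ·∫e^{−V}` (a `θ`-median; `θ = ½` exists by `exists_median_halfSpaceMass`) and the prescribed centre `c_i` is within `δ` of
it, then the slab of half-width `ρ + δ` about `c` carries all but `η = 2|ι|e^{−λρ²∕4}∕θ` of the mass — the instance supplies only `δ`
(PRICING-NE7b v81 F428's suggested socket). [folklore] -/
theorem slabWindowMass_ge_of_near_medians {ι : Type*} [Fintype ι] {V : EuclideanSpace ℝ (Fin n) → ℝ} {lam : ℝ}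
    (hlam : 0 < lam) (hVc : Continuous V)
    (hV : ∀ x y : EuclideanSpace ℝ (Fin n), V x + ⟪gradient V x, y - x⟫ + lam / 2 * ‖y - x‖ ^ 2 ≤ V y)
    (hZ : Integrable fun x => exp (-V x)) (u : ι → EuclideanSpace ℝ (Fin n)) (hu : ∀ i, ‖u i‖ ≤ 1)
    (m c : ι → ℝ) {ρ θ δ : ℝ} (hρ : 0 ≤ ρ) (hθ : 0 < θ)
    (hlo : ∀ i, θ * ∫ z, exp (-V z) ≤ ∫ x in {x | ⟪u i, x⟫ ≤ m i}, exp (-V x))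
    (hhi : ∀ i, θ * ∫ z, exp (-V z) ≤ ∫ x in {x | m i ≤ ⟪u i, x⟫}, exp (-V x))
    (hnear : ∀ i, |m i - c i| ≤ δ) :
    (1 - 2 * Fintype.card ι * exp (-(lam * ρ ^ 2 / 4)) / θ) * ∫ z, exp (-V z) ≤
      ∫ x in {x | ∀ i, |⟪u i, x⟫ - c i| < ρ + δ}, exp (-V x) :=
  (slabWindowMass_ge hlam hVc hV hZ u hu m hρ hθ hlo hhi).trans (setIntegral_slab_mono_of_near hZ u hnear)

end Summit.QuantumFields.BalabanUV.T4Continuum.NE7b.ConvexSlabWindowMedians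

end
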